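import Summits.BirchSwinnertonDyer.BirchSwinnertonDyer.Theorems.RamifiedHeegnerPairLeafSigmaStarTightData
import Literature.NumberTheory.EllipticCurves.MatarNekovar2019.ShaStructureIrreducible
import HarnessLib

/-!
# Route `RamifiedHeegnerPair` (rev 11) — the research child Σ★″ (item 27493 `LeafSigmaStarDivisibilityAtThreeOptimalOffRows`)
# is TIGHT on the WHOLE leaf: it FOLLOWS, BY NAME, from BSD₃ on the leaf (`WAllExclAddGssAtThree`) and print, once
# Kolyvagin's structure theorem is taken in its IRREDUCIBLE-image form (Matar–Nekovář 2019 §0.11, named fact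
# `MatarNekovar2019.thm07_pow_dvd_card_sha_primary_of_certificate_of_irreducible`) — no `ρ̄₃`-onto row restriction
# (lead prover bsd-line-rhp-p2 g6; `--supports stmt-BirchSwinnertonDyer-27493`, helper; BSD is not proved by any of this)

Sibling of `RamifiedHeegnerPairLeafSigmaStarTightData.lean` / `…TightOnto.lean` (same argument with McCallum 1991 Cor. 5.6, whose
printed hypothesis is `Gal(ℚ(E_p)/ℚ) = GL₂(𝔽_p)`, hence the restriction to the 257 onto classes there). Matar–Nekovář 2019 §0.11
(with Cha 2005 Rmk. 25; MN 2021 correction) remove the surjectivity: the structure theorem holds for `ρ̄_{E,p}` IRREDUCIBLE, `p` odd,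
`d_K ∉ {−3, −4}`, with no reduction hypothesis at `p` — and `E[3]` is irreducible on the whole Gss2 leaf (`classX4_three_of_addv_of_subGss`).
So a FAILURE of Σ★″ at `s′ = M + 1` (a derived point `P_n`, `n ∈ S(M+1)`, not `3^{M+1}`-divisible) forces `3^{2(M₀−M)} ∣ #Ш(E/K)[3^∞]`
on EVERY leaf row, while `BSD₃(E) ∧ BSD₃(E^{d_K})` and the exact Gross–Zagier bookkeeping give `ord₃ #Ш(E/K) + 2·ord₃∏c_ℓ + 2·v₃|c| ≤ 2M₀`
(rank-one orientation: SOED's `indexBounds_of_bsdp_of_partner_bsdp`; rank-zero: the sibling's `indexUpperBoundLeAt_rankZero_of_jointUpperBoundAt`,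
`3 ∤ c`): `M ≥ ord₃∏c_ℓ + v₃|c| ≥ M + 1`, absurd.

* §1–§2 `pDiv_of_bsdp_of_partner_bsdp_rankOne_of_irreducible` / `…_rankZero_of_irreducible` — DATA level, the sibling's two theorems with
  {McCallum fact, tower onto} replaced by {MN §0.11 fact, `E[3]` irreducible}.
* §3 `leafSigmaStarDivisibilityAtThreeOptimalOffRows_of_wAllExclAddGssAtThree` — **the route item 27493 BY NAME from the leaf + print**
  (orientation read off the non-torsion Heegner point as in `…TightOnto`; the off-rows clause is idle).
* §4 `leafSigmaStarDivisibilityAtThreeOptimalOffRows_of_members` — 27493 BY NAME from the four members L₁ 26021, U₁ 26022, L₀ 26023,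
  U₀ 26024 (through `closes`). With p622097 / the glue 27494 (U₁ ⟸ PUB⁺ ∧ S2 ∧ Σ★″ [∧ L₀]) this makes Σ★″ and U₁ ∧ U₀ EQUIVALENT on
  the whole leaf modulo {PUB⁺, S2, L₁, L₀, MN §0.11}: the research child carries NO SURPLUS over BSD₃ anywhere on the leaf, and any
  certificate refuting Σ★″ (one derived point at one Kolyvagin prime not divisible to the budget) refutes BSD₃ on the leaf.
* §5 (appended) `wAllExclAddGssAtThree_iff_leafSigmaStar_of_reading_of_lowerMembers` — modulo 17 named facts, S2 (27492), L₁, L₀: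
  `WAllExclAddGssAtThree ↔ LeafSigmaStarDivisibilityAtThreeOptimalOffRows` ((←) = g5's capstone p622097).
CONDITIONAL on the displayed named facts (the MN §0.11 fact carries the referee flags `MN19-0.11-structure-composite`,
`Kolyvagin1991-ThmCD-primary-unread` of its file) and on the leaf / the members as hypotheses; nothing is asserted; BSD is not proved.
References: [MatarNekovar2019] Thm. 0.7, §0.11; [Cha2005] Rmk. 25; [McCallumLMS1991] §5 Cor. 5.6; [GrossZagier1986] I.(6.3), (7.3), V.(2.2);
[Gross1991] (1.1), Thm. 1.3; [Jetchev2008] Conj. 1.3; [Miller2011LMS] Def. 1.1; [Mazur1978] Cor. 4.1.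
-/

-- D-0017: single-problem summit, so `Summit.BirchSwinnertonDyer.BirchSwinnertonDyer.…` repeats a namespace BY DESIGN.
set_option linter.dupNamespace false
set_option autoImplicit false

noncomputable section

open scoped Classical NumberField

open WeierstrassCurve NumberField IsDedekindDomain Literature Literature.NumberTheory.EllipticCurves
  Literature.NumberTheory.EllipticCurves.ModularForms
  Literature.NumberTheory.EllipticCurves.Rank1Residual
  Literature.NumberTheory.EllipticCurves.Rank1Residual.Typed
  Summit.BirchSwinnertonDyer.Rank1Residual
  Summit.BirchSwinnertonDyer.Rank1Residual.Additive
  Summit.BirchSwinnertonDyer.Rank1Residual.X11b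
  Summit.BirchSwinnertonDyer.BirchSwinnertonDyer.Theses.RamifiedHeegnerPair
  Summit.BirchSwinnertonDyer.BirchSwinnertonDyer.Theorems

namespace Summit.BirchSwinnertonDyer.BirchSwinnertonDyer.Theorems.RamifiedPairUpperBound

/-! ## §1 DATA level, rank-one orientation, `E[3]` irreducible -/

/-- **Σ at one frame from `BSD₃(E) ∧ BSD₃(E^{d_K})`, rank-one orientation, IRREDUCIBLE image** — the sibling's
`pDiv_of_bsdp_of_partner_bsdp_rankOne` with McCallum Cor. 5.6 replaced by its irreducible-image form (Matar–Nekovář 2019 §0.11,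
named fact `hMN`) and the tower-onto binder by `ρ̄_{E,3}` irreducible. CONDITIONAL; nothing asserted.
[cite: MatarNekovar2019, Thm. 0.7 (p. 456) and §0.11 (p. 457)] [cite: McCallumLMS1991, §5 Cor. 5.6 (p. 310) and Lemma 5.1 (p. 303)]
[cite: GrossZagier1986, Thm. I.(6.3) and (7.3)] [cite: Miller2011LMS, Def. 1.1] -/
theorem pDiv_of_bsdp_of_partner_bsdp_rankOne_of_irreducible
    (hGZ : ∀ (N : ℕ) [NeZero N] (W : WeierstrassCurve ℚ) (K : Type) [Field K] [NumberField K],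
      gross_zagier N W K)
    (hKo : ∀ (N : ℕ) [NeZero N] (W : WeierstrassCurve ℚ) (K : Type) [Field K] [NumberField K],
      kolyvagin N W K)
    (hGZK : rank_eq_analyticRank_of_analyticRank_le_one) (hmod : hasEntireLFunction_rat)
    (hGZ73 : GrossZagier1986_thm_I_7_3)
    (hrec : ∀ (N : ℕ) [NeZero N] (W : WeierstrassCurve ℚ) (K : Type) [Field K] [NumberField K],
      heegnerPointOfConductor_one_galoisConj N W K)
    (h36 : ∀ (N : ℕ) [NeZero N] (W : WeierstrassCurve ℚ) (K : Type) [Field K] [NumberField K],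
      phi_heegnerTau_mem_range_map_singularModuliField N W K)
    (hMN : MatarNekovar2019.thm07_pow_dvd_card_sha_primary_of_certificate_of_irreducible)
    (W : WeierstrassCurve ℚ) [W.IsElliptic] [W.IsGloballyMinimal] (N : ℕ) [NeZero N]
    (K : Type) [Field K] [NumberField K]
    (Dt : ModularParametrizationData W N) (H : HeegnerDatum N (NumberField.discr K)) (ι : K →+* ℂ)
    (P : (W.baseChange K).toAffine.Point)
    (hCM : ¬ W.HasCM) (h3N : 3 ∣ W.conductorNorm ℤ) (hN : W.conductorNorm ℤ = N)
    (hirr : W.HasIrreducibleModPGaloisRep 3)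
    (hK : IsImaginaryQuadratic K) (hHN : SatisfiesHeegnerHypothesis N K) (hodd : Odd (NumberField.discr K))
    (hr : W.analyticRank = 1) (hLt : (W.quadraticTwist (NumberField.discr K : ℚ)).entireLFunction 1 ≠ 0)
    (hP : WeierstrassCurve.Affine.Point.map ι.toRatAlgHom P = heegnerPointComplex Dt H)
    (Wd : WeierstrassCurve ℚ) [Wd.IsElliptic] [Wd.IsGloballyMinimal] (Cd : VariableChange ℚ)
    (hWd : Cd • W.quadraticTwist (NumberField.discr K : ℚ) = Wd)
    (hBW : BSDp W 3) (hBWd : BSDp Wd 3)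
    {s' : ℕ} (hs' : s' ≤ padicValNat 3 W.tamagawaProduct + padicValNat 3 Dt.c.natAbs)
    {n : ℕ} (d : KolyvaginHeegnerData Dt H.β ι n) (hn : Squarefree n)
    (hℓ : ∀ ℓ ∈ n.primeFactors, Zhang2014.IsKolyvaginPrime N W K 3 ℓ ∧ s' ≤ Zhang2014.kolyvaginIndex W 3 ℓ) :
    Three.Koly.PDiv d 3 s' := by
  haveI h3p : Fact (Nat.Prime 3) := ⟨Nat.prime_three⟩
  have hp2 : (3 : ℕ) ≠ 2 := by decide
  subst hN
  -- `s' = 0` is trivial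
  rcases Nat.eq_zero_or_pos s' with hs0 | hs0
  · subst hs0
    exact ⟨d.derivedPoint, by simp⟩
  obtain ⟨M, rfl⟩ : ∃ M, s' = M + 1 := ⟨s' - 1, by omega⟩
  by_contra hcert
  -- `3 ∣ N_W` splits in `K`: `3 ∤ d_K`, `3 ∤ #𝓞_K^×`; `d_K ≠ -3, -4`
  obtain ⟨hd3, hμ⟩ := X11b.Three.not_dvd_discr_and_not_dvd_torsionOrder_of_heegner hK hHN hp2 h3N
  have h3 : NumberField.discr K ≠ -3 := fun h ↦ hd3 (h ▸ ⟨-1, by norm_num⟩)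
  have h4 : NumberField.discr K ≠ -4 := fun h ↦ by
    rw [h] at hodd
    exact (Int.not_odd_iff_even.mpr ⟨-2, by norm_num⟩) hodd
  -- the conductor-`1` Kolyvagin–Heegner datum (Darmon Thm. 3.6) with `P_1 = y_K = P` in `E(K̄)` (Shimura reciprocity)
  obtain ⟨d₁⟩ := nonempty_kolyvaginHeegnerData_one_of_darmon36 (h36 _ W K) hK Dt H.β ι H.dvd_sq_sub
  have hPd : d₁.toGeomPoints d₁.derivedPoint = toGeomPoints (W.baseChange K) P :=
    KolyvaginBottom.toGeomPoints_derivedPoint_one_eq (hrec _ W K) hK hHN hP d₁ rfl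
  -- `P` non-torsion (Gross–Zagier), rank one and `Ш(E/K)` finite (Kolyvagin)
  have hPinf : ¬ IsOfFinAddOrder P :=
    not_isOfFinAddOrder_of_heegner_of_analyticRank_eq_one W (W.conductorNorm ℤ) K Dt H ι P (hGZ _ W K) hmod hr hK
      hHN hLt hP
  obtain ⟨hrank, hSha⟩ := hKo (W.conductorNorm ℤ) W K hK hHN ⟨Dt, H, ι, hP⟩ hPinf
  haveI : Finite (W.baseChange K).sha := hSha
  -- `E(K)[3] = 0`
  have hbot := torsionBy_eq_bot_of_isImaginaryQuadratic_of_hasIrreducibleModPGaloisRep W K hK Nat.prime_three hirr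
  have hiv : ∀ x : (W.baseChange K).toAffine.Point, (3 : ℕ) • x = 0 → x = 0 := fun x hx ↦ by
    have hmem : x ∈ AddSubgroup.torsionBy (W.baseChange K).toAffine.Point (((3 : ℕ) : ℕ) : ℤ) := by
      rw [mem_torsionBy_iff, natCast_zsmul]
      exact hx
    rw [hbot] at hmem
    exact hmem
  -- `3^{M₀} ∥ P` in `E(K)`
  haveI : Module.Finite ℤ (W.baseChange K).toAffine.Point := (W.baseChange K).module_finite_point_holds
  obtain ⟨M₀, x₀, hx₀, hmax⟩ := exists_pow_smul_eq_and_forall_ne hPinf (p := 3) Nat.prime_three.two_le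
  have hdiv : ∃ Q : (W.baseChange K).toAffine.Point, ((3 ^ M₀ : ℕ) : ℤ) • Q = P :=
    ⟨x₀, by rw [natCast_zsmul]; exact hx₀⟩
  have hndiv : ¬ ∃ Q : (W.baseChange K).toAffine.Point, ((3 ^ (M₀ + 1) : ℕ) : ℤ) • Q = P := by
    rintro ⟨Q, hQ⟩
    exact hmax Q (by rw [← natCast_zsmul]; exact hQ)
  -- McCallum Cor. 5.6 at the certificate: `2(M₀ − M) ≤ ord₃ #Ш(E/K)[3^∞]`
  have hdvd := hMN W hCM K hK h3 h4 hHN 3 hp2 hirr Dt H.β ι d₁ P hPd hPinf M₀ hdiv hndiv n M d hn hℓ hcert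
  have hcard : Nat.card (AddCommGroup.primaryComponent (W.baseChange K).sha 3) ≠ 0 := Nat.card_pos.ne'
  have hMc' : 2 * (M₀ - M) ≤ padicValNat 3 (Nat.card (AddCommGroup.primaryComponent (W.baseChange K).sha 3)) :=
    (padicValNat_dvd_iff_le hcard).mp hdvd
  have hsha : padicValNat 3 (W.baseChange K).shaOrder =
      padicValNat 3 (Nat.card (AddCommGroup.primaryComponent (W.baseChange K).sha 3)) :=
    Three.Koly.padicValNat_shaOrder_eq (W.baseChange K) 3
  -- `ord₃ [E(K) : ℤP] = M₀`
  haveI : Finite (AddCommGroup.torsion (W.baseChange K).toAffine.Point) :=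
    WeierstrassCurve.finite_torsion_point (W := W.baseChange K)
  obtain ⟨c, Q, hcQ, hcker⟩ := RankOne.exists_coord_of_mordellWeilRank_eq_one (W.baseChange K) hrank
  have hidx : padicValNat 3 (AddSubgroup.zmultiples P).index = M₀ :=
    Three.Koly.padicValNat_index_zmultiples_eq_of_divisibility c Q hcQ hcker hiv P hdiv hndiv
  -- BSD₃ of the pair: the co-STEP-L socket at slack `v₃|c|`
  obtain ⟨-, hup⟩ := WildKolyvaginUpperAtThreeTight.indexBounds_of_bsdp_of_partner_bsdp hGZ hKo hGZK hmod hGZ73 W 3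
    (W.conductorNorm ℤ) K Dt H ι P Wd hr rfl h3N hK hodd hμ hHN hLt hP ⟨Cd, hWd⟩ hp2 hBW hBWd
  unfold SchneiderFree.Upper.IndexUpperBoundLeAt at hup
  rw [hidx, hsha] at hup
  omega

/-! ## §2 DATA level, rank-zero orientation, `E[3]` irreducible -/

/-- **Σ at one frame from `BSD₃(E) ∧ BSD₃(E^{d_K})`, rank-ZERO orientation, IRREDUCIBLE image** (`3 ∤ c(Dt)`) — the sibling's
`pDiv_of_bsdp_of_partner_bsdp_rankZero` with {McCallum, tower onto} ↦ {MN §0.11, irreducible}. CONDITIONAL; nothing asserted.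
[cite: MatarNekovar2019, Thm. 0.7 (p. 456) and §0.11 (p. 457)] [cite: GrossZagier1986, Thm. I.(6.3) and V (2.2)] [cite: Miller2011LMS, Def. 1.1] -/
theorem pDiv_of_bsdp_of_partner_bsdp_rankZero_of_irreducible
    (hGZ : ∀ (N : ℕ) [NeZero N] (W : WeierstrassCurve ℚ) (K : Type) [Field K] [NumberField K],
      gross_zagier N W K)
    (hKo : ∀ (N : ℕ) [NeZero N] (W : WeierstrassCurve ℚ) (K : Type) [Field K] [NumberField K],
      kolyvagin N W K)
    (hGZK : rank_eq_analyticRank_of_analyticRank_le_one) (hmod : hasEntireLFunction_rat)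
    (hrec : ∀ (N : ℕ) [NeZero N] (W : WeierstrassCurve ℚ) (K : Type) [Field K] [NumberField K],
      heegnerPointOfConductor_one_galoisConj N W K)
    (h36 : ∀ (N : ℕ) [NeZero N] (W : WeierstrassCurve ℚ) (K : Type) [Field K] [NumberField K],
      phi_heegnerTau_mem_range_map_singularModuliField N W K)
    (hMN : MatarNekovar2019.thm07_pow_dvd_card_sha_primary_of_certificate_of_irreducible)
    (W : WeierstrassCurve ℚ) [W.IsElliptic] [W.IsGloballyMinimal] (N : ℕ) [NeZero N]
    (K : Type) [Field K] [NumberField K]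
    (Dt : ModularParametrizationData W N) (H : HeegnerDatum N (NumberField.discr K)) (ι : K →+* ℂ)
    (P : (W.baseChange K).toAffine.Point)
    (hCM : ¬ W.HasCM) (h3N : 3 ∣ W.conductorNorm ℤ) (hN : W.conductorNorm ℤ = N)
    (hirr : W.HasIrreducibleModPGaloisRep 3)
    (hK : IsImaginaryQuadratic K) (hHN : SatisfiesHeegnerHypothesis N K) (hodd : Odd (NumberField.discr K))
    (hr : W.analyticRank = 0)
    (hP : WeierstrassCurve.Affine.Point.map ι.toRatAlgHom P = heegnerPointComplex Dt H)
    (hnt : ¬ IsOfFinAddOrder P) (hc : ¬ (3 : ℤ) ∣ Dt.c)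
    (Wd : WeierstrassCurve ℚ) [Wd.IsElliptic] [Wd.IsGloballyMinimal] (Cd : VariableChange ℚ)
    (hWd : Cd • W.quadraticTwist (NumberField.discr K : ℚ) = Wd) (hrd : Wd.analyticRank = 1)
    (hBW : BSDp W 3) (hBWd : BSDp Wd 3)
    {s' : ℕ} (hs' : s' ≤ padicValNat 3 W.tamagawaProduct + padicValNat 3 Dt.c.natAbs)
    {n : ℕ} (d : KolyvaginHeegnerData Dt H.β ι n) (hn : Squarefree n)
    (hℓ : ∀ ℓ ∈ n.primeFactors, Zhang2014.IsKolyvaginPrime N W K 3 ℓ ∧ s' ≤ Zhang2014.kolyvaginIndex W 3 ℓ) :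
    Three.Koly.PDiv d 3 s' := by
  haveI h3p : Fact (Nat.Prime 3) := ⟨Nat.prime_three⟩
  have hp2 : (3 : ℕ) ≠ 2 := by decide
  subst hN
  rcases Nat.eq_zero_or_pos s' with hs0 | hs0
  · subst hs0
    exact ⟨d.derivedPoint, by simp⟩
  obtain ⟨M, rfl⟩ : ∃ M, s' = M + 1 := ⟨s' - 1, by omega⟩
  by_contra hcert
  obtain ⟨hd3, hμ⟩ := X11b.Three.not_dvd_discr_and_not_dvd_torsionOrder_of_heegner hK hHN hp2 h3N
  have h3 : NumberField.discr K ≠ -3 := fun h ↦ hd3 (h ▸ ⟨-1, by norm_num⟩)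
  have h4 : NumberField.discr K ≠ -4 := fun h ↦ by
    rw [h] at hodd
    exact (Int.not_odd_iff_even.mpr ⟨-2, by norm_num⟩) hodd
  obtain ⟨d₁⟩ := nonempty_kolyvaginHeegnerData_one_of_darmon36 (h36 _ W K) hK Dt H.β ι H.dvd_sq_sub
  have hPd : d₁.toGeomPoints d₁.derivedPoint = toGeomPoints (W.baseChange K) P :=
    KolyvaginBottom.toGeomPoints_derivedPoint_one_eq (hrec _ W K) hK hHN hP d₁ rfl
  obtain ⟨hrank, hSha⟩ := hKo (W.conductorNorm ℤ) W K hK hHN ⟨Dt, H, ι, hP⟩ hnt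
  haveI : Finite (W.baseChange K).sha := hSha
  have hbot := torsionBy_eq_bot_of_isImaginaryQuadratic_of_hasIrreducibleModPGaloisRep W K hK Nat.prime_three hirr
  have hiv : ∀ x : (W.baseChange K).toAffine.Point, (3 : ℕ) • x = 0 → x = 0 := fun x hx ↦ by
    have hmem : x ∈ AddSubgroup.torsionBy (W.baseChange K).toAffine.Point (((3 : ℕ) : ℕ) : ℤ) := by
      rw [mem_torsionBy_iff, natCast_zsmul]
      exact hx
    rw [hbot] at hmem
    exact hmem
  haveI : Module.Finite ℤ (W.baseChange K).toAffine.Point := (W.baseChange K).module_finite_point_holds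
  obtain ⟨M₀, x₀, hx₀, hmax⟩ := exists_pow_smul_eq_and_forall_ne hnt (p := 3) Nat.prime_three.two_le
  have hdiv : ∃ Q : (W.baseChange K).toAffine.Point, ((3 ^ M₀ : ℕ) : ℤ) • Q = P :=
    ⟨x₀, by rw [natCast_zsmul]; exact hx₀⟩
  have hndiv : ¬ ∃ Q : (W.baseChange K).toAffine.Point, ((3 ^ (M₀ + 1) : ℕ) : ℤ) • Q = P := by
    rintro ⟨Q, hQ⟩
    exact hmax Q (by rw [← natCast_zsmul]; exact hQ)
  have hdvd := hMN W hCM K hK h3 h4 hHN 3 hp2 hirr Dt H.β ι d₁ P hPd hnt M₀ hdiv hndiv n M d hn hℓ hcert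
  have hcard : Nat.card (AddCommGroup.primaryComponent (W.baseChange K).sha 3) ≠ 0 := Nat.card_pos.ne'
  have hMc' : 2 * (M₀ - M) ≤ padicValNat 3 (Nat.card (AddCommGroup.primaryComponent (W.baseChange K).sha 3)) :=
    (padicValNat_dvd_iff_le hcard).mp hdvd
  have hsha : padicValNat 3 (W.baseChange K).shaOrder =
      padicValNat 3 (Nat.card (AddCommGroup.primaryComponent (W.baseChange K).sha 3)) :=
    Three.Koly.padicValNat_shaOrder_eq (W.baseChange K) 3
  haveI : Finite (AddCommGroup.torsion (W.baseChange K).toAffine.Point) :=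
    WeierstrassCurve.finite_torsion_point (W := W.baseChange K)
  obtain ⟨c, Q, hcQ, hcker⟩ := RankOne.exists_coord_of_mordellWeilRank_eq_one (W.baseChange K) hrank
  have hidx : padicValNat 3 (AddSubgroup.zmultiples P).index = M₀ :=
    Three.Koly.padicValNat_index_zmultiples_eq_of_divisibility c Q hcQ hcker hiv P hdiv hndiv
  -- `v₃|c| = 0`
  have hc0 : padicValNat 3 Dt.c.natAbs = 0 :=
    padicValNat.eq_zero_of_not_dvd fun h ↦ hc (Int.ofNat_dvd_left.mpr h)
  -- the JOINT upper half from the two BSD₃'s, then §2's socket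
  have hJ : SchneiderFree.Upper.JointUpperBoundAt W Wd 3 :=
    WildKolyvaginUpperAtThreeTight.jointUpperBoundAt_of_bsdp_of_bsdp hGZK W Wd 3 (by rw [hr]; exact zero_le_one)
      (by rw [hrd]) hBW hBWd
  have hup := indexUpperBoundLeAt_rankZero_of_jointUpperBoundAt hGZ hKo hGZK hmod W 3 (W.conductorNorm ℤ) K Dt H ι P
    Wd hr rfl h3N hK hodd hμ hHN hP Cd hWd hrd hp2 hc hJ
  unfold SchneiderFree.Upper.IndexUpperBoundLeAt at hup
  rw [hidx, hsha] at hup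
  omega

/-! ## §3 CLASS level: the route item Σ★″ (27493) BY NAME from the leaf + print — all rows -/

/-- **Σ★″ = item 27493 `LeafSigmaStarDivisibilityAtThreeOptimalOffRows` BY NAME ⟸ the leaf `WAllExclAddGssAtThree` + print, on the
WHOLE leaf.** Named facts as hypotheses: Gross–Zagier, Kolyvagin, GZK, modularity (Version L), Gross–Zagier I.(7.3), Shimura
reciprocity at conductor `1`, Darmon Thm. 3.6, the irreducible-image structure theorem (Matar–Nekovář 2019 §0.11, `hMN`), and —
for `3 ∤ c` of the lattice-optimal datum on the `I₀*` fibre — Mazur Cor. 4.1, Abbes–Ullmo Thm. A, Česnavičius Thm. 1.2, newform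
of `E`. `E[3]` is irreducible on the leaf (`classX4_three_of_addv_of_subGss`); the orientation is read off the non-torsion Heegner
point (`L′(E/K,1) ≠ 0` ⟹ `r_an(E) + r_an(E^{d_K}) ≤ 1`; `rank E(K) = 1 = rank E + rank E^{d_K}`; GZK); the minimal twist model is a
non-CM leaf curve (`leaf_twist_of_heegner`), so the leaf pays `BSD₃` of both members; §1/§2 finish. The off-rows clause is idle.
CONDITIONAL on the leaf (a conjecture, hypothesis `hLeaf`) and the named facts; nothing asserted; BSD is not proved.
[cite: MatarNekovar2019, Thm. 0.7 (p. 456) and §0.11 (p. 457)] [cite: Jetchev2008, Conj. 1.3 (p. 812)]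
[cite: GrossZagier1986, Thm. I.(6.3), (7.3), V (2.2)] [cite: Gross1991, (1.1) and Thm. 1.3] [cite: Mazur1978, Cor. 4.1]
[cite: Miller2011LMS, Def. 1.1] -/
theorem leafSigmaStarDivisibilityAtThreeOptimalOffRows_of_wAllExclAddGssAtThree
    (hGZ : ∀ (N : ℕ) [NeZero N] (W : WeierstrassCurve ℚ) (K : Type) [Field K] [NumberField K],
      gross_zagier N W K)
    (hKo : ∀ (N : ℕ) [NeZero N] (W : WeierstrassCurve ℚ) (K : Type) [Field K] [NumberField K],
      kolyvagin N W K)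
    (hGZK : rank_eq_analyticRank_of_analyticRank_le_one) (hmod : hasEntireLFunction_rat)
    (hGZ73 : GrossZagier1986_thm_I_7_3)
    (hrec : ∀ (N : ℕ) [NeZero N] (W : WeierstrassCurve ℚ) (K : Type) [Field K] [NumberField K],
      heegnerPointOfConductor_one_galoisConj N W K)
    (h36 : ∀ (N : ℕ) [NeZero N] (W : WeierstrassCurve ℚ) (K : Type) [Field K] [NumberField K],
      phi_heegnerTau_mem_range_map_singularModuliField N W K)
    (hMN : MatarNekovar2019.thm07_pow_dvd_card_sha_primary_of_certificate_of_irreducible)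
    (hM : mazur_not_dvd_maninConstant_of_odd) (hAU : abbesUllmo_not_dvd_maninConstant_of_not_dvd_level)
    (hC2 : cesnavicius_not_two_dvd_maninConstant_of_two_dvd_level) (hnf : exists_isNewformOf)
    (hLeaf : Summit.BirchSwinnertonDyer.WAllExclAddGssAtThree) :
    LeafSigmaStarDivisibilityAtThreeOptimalOffRows := by
  intro W _ _ N _ K _ _ Dt H ι P hCM hadd hsub hN hopt _hrow hK hHN hP hnt hodd s' hs' n d hn hℓ
  haveI h3p : Fact (Nat.Prime 3) := ⟨Nat.prime_three⟩
  have h3N : 3 ∣ W.conductorNorm ℤ :=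
    (W.dvd_conductorNorm_iff_not_hasGoodReductionAtPrime 3).mpr (not_good_of_addv W 3 hadd)
  have hHN' : SatisfiesHeegnerHypothesis (W.conductorNorm ℤ) K := by rw [hN]; exact hHN
  -- `E[3]` is irreducible on the leaf
  have hirr : W.HasIrreducibleModPGaloisRep 3 := (classX4_three_of_addv_of_subGss W hadd hsub).2.2
  -- a globally minimal model of the twist: again a non-CM leaf curve
  have hD0 : (NumberField.discr K : ℚ) ≠ 0 := by exact_mod_cast NumberField.discr_ne_zero K
  haveI : (W.quadraticTwist (NumberField.discr K : ℚ)).IsElliptic := W.isElliptic_quadraticTwist hD0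
  obtain ⟨Cd, hCd⟩ := hasGlobalMinimalModel_rat_holds (W.quadraticTwist (NumberField.discr K : ℚ))
  haveI : (Cd • W.quadraticTwist (NumberField.discr K : ℚ)).IsGloballyMinimal := hCd
  set Wd := Cd • W.quadraticTwist (NumberField.discr K : ℚ) with hWd_def
  obtain ⟨hCMd, haddd, hsubd, -⟩ := leaf_twist_of_heegner W hCM hadd hsub K hK hHN' hodd Wd Cd rfl
  have hrdt : Wd.analyticRank = (W.quadraticTwist (NumberField.discr K : ℚ)).analyticRank :=
    WeierstrassCurve.analyticRank_smul (W.quadraticTwist (NumberField.discr K : ℚ)) Cd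
  -- the orientation: exactly one member has analytic rank one
  have hLK : LDerivEK W K ≠ 0 :=
    (lDerivEK_ne_zero_iff_not_isOfFinAddOrder W N K (hGZ N W K) hK hHN ⟨Dt, H, ι, hP⟩).mpr hnt
  have hsum : W.analyticRank + (W.quadraticTwist (NumberField.discr K : ℚ)).analyticRank ≤ 1 :=
    ShimuraKolyvaginTransport.analyticRank_add_le_one_of_LDerivEK_ne_zero W K hmod hLK
  have hrW : W.analyticRank ≤ 1 := by omega
  have hrWd : Wd.analyticRank ≤ 1 := by omega
  obtain ⟨hrankK, -⟩ := hKo N W K hK hHN ⟨Dt, H, ι, hP⟩ hnt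
  have hsplit := mordellWeilRank_baseChange_quadratic_holds W K hK.1
  have hrkW : W.mordellWeilRank = W.analyticRank := (hGZK W hrW).1
  have hrkWd : Wd.mordellWeilRank = Wd.analyticRank := (hGZK Wd hrWd).1
  have hrkWd' : Wd.mordellWeilRank = (W.quadraticTwist (NumberField.discr K : ℚ)).mordellWeilRank :=
    WeierstrassCurve.mordellWeilRank_variableChange_holds (W.quadraticTwist (NumberField.discr K : ℚ)) Cd
  have hone : W.analyticRank + Wd.analyticRank = 1 := by omega
  -- BSD₃ of both members from the leaf
  have hBW : BSDp W 3 := hLeaf W hCM hadd hsub hrW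
  have hBWd : BSDp Wd 3 := hLeaf Wd hCMd haddd hsubd hrWd
  rcases Nat.eq_zero_or_pos W.analyticRank with hr0 | hr1
  · -- rank-ZERO orientation: `3 ∤ c` for the lattice-optimal datum on the `I₀*` fibre
    have hrd : Wd.analyticRank = 1 := by omega
    have hc : ¬ (3 : ℤ) ∣ Dt.c := not_three_dvd_c_of_latticeOptimal_of_subGss hM hAU hC2 hnf W Dt hopt hadd hsub
    exact pDiv_of_bsdp_of_partner_bsdp_rankZero_of_irreducible hGZ hKo hGZK hmod hrec h36 hMN W N K Dt H ι P hCM h3N hN hirr hK hHN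
      hodd hr0 hP hnt hc Wd Cd rfl hrd hBW hBWd hs' d hn hℓ
  · -- rank-ONE orientation
    have hr : W.analyticRank = 1 := by omega
    have hrd : Wd.analyticRank = 0 := by omega
    have hLt : (W.quadraticTwist (NumberField.discr K : ℚ)).entireLFunction 1 ≠ 0 :=
      (analyticRank_eq_zero_iff_L_one_ne_zero_of_hasEntireLFunction_rat hmod _).mp (hrdt ▸ hrd)
    exact pDiv_of_bsdp_of_partner_bsdp_rankOne_of_irreducible hGZ hKo hGZK hmod hGZ73 hrec h36 hMN W N K Dt H ι P hCM h3N hN hirr hK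
      hHN hodd hr hLt hP Wd Cd rfl hBW hBWd hs' d hn hℓ

/-! ## §4 Σ★″ (27493) BY NAME from the four member items + print -/

/-- **Σ★″ = item 27493 BY NAME ⟸ the four MEMBER items L₁ (26021), U₁ (26022), L₀ (26023), U₀ (26024) + print**, through the route's
`closes`. With the glue 27494 (U₁ ⟸ PUB⁺ ∧ S2 ∧ Σ★″, modulo L₀) and p622097 (leaf ⟸ PUB★⁺ ∧ S2 ∧ Σ★″ ∧ L₁ ∧ L₀): Σ★″ and U₁ ∧ U₀ are
EQUIVALENT on the whole leaf modulo {PUB⁺, S2, L₁, L₀, MN §0.11}. CONDITIONAL; nothing asserted; BSD is not proved.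
[cite: MatarNekovar2019, §0.11 (p. 457)] [cite: Jetchev2008, Conj. 1.3 (p. 812)] [cite: Miller2011LMS, Def. 1.1] -/
theorem leafSigmaStarDivisibilityAtThreeOptimalOffRows_of_members
    (hGZ : ∀ (N : ℕ) [NeZero N] (W : WeierstrassCurve ℚ) (K : Type) [Field K] [NumberField K],
      gross_zagier N W K)
    (hKo : ∀ (N : ℕ) [NeZero N] (W : WeierstrassCurve ℚ) (K : Type) [Field K] [NumberField K],
      kolyvagin N W K)
    (hGZK : rank_eq_analyticRank_of_analyticRank_le_one) (hmod : hasEntireLFunction_rat)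
    (hGZ73 : GrossZagier1986_thm_I_7_3)
    (hrec : ∀ (N : ℕ) [NeZero N] (W : WeierstrassCurve ℚ) (K : Type) [Field K] [NumberField K],
      heegnerPointOfConductor_one_galoisConj N W K)
    (h36 : ∀ (N : ℕ) [NeZero N] (W : WeierstrassCurve ℚ) (K : Type) [Field K] [NumberField K],
      phi_heegnerTau_mem_range_map_singularModuliField N W K)
    (hMN : MatarNekovar2019.thm07_pow_dvd_card_sha_primary_of_certificate_of_irreducible)
    (hM : mazur_not_dvd_maninConstant_of_odd) (hAU : abbesUllmo_not_dvd_maninConstant_of_not_dvd_level)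
    (hC2 : cesnavicius_not_two_dvd_maninConstant_of_two_dvd_level) (hnf : exists_isNewformOf)
    (hL1 : Gss2LowerAtThreeRankOne) (hU1 : LeafRankOneUpperAtThree) (hL0 : Gss2LowerAtThreeRankZero)
    (hU0 : LeafRankZeroUpperAtThree) :
    LeafSigmaStarDivisibilityAtThreeOptimalOffRows :=
  leafSigmaStarDivisibilityAtThreeOptimalOffRows_of_wAllExclAddGssAtThree hGZ hKo hGZK hmod hGZ73 hrec h36 hMN hM hAU hC2 hnf
    (closes hGZK hL1 hU1 hL0 hU0)

/-! ## §5 (appended) The leaf and the research child are EQUIVALENT modulo print, the reading S2 and the two lower members -/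

/-- **`WAllExclAddGssAtThree ↔ LeafSigmaStarDivisibilityAtThreeOptimalOffRows` modulo {17 named facts, S2 (item 27492), L₁ (26021),
L₀ (26023)}.** (→) is §3 (`leafSigmaStarDivisibilityAtThreeOptimalOffRows_of_wAllExclAddGssAtThree`: structure theorem in the irreducible
form + exact Gross–Zagier bookkeeping); (←) is g5's capstone p622097
`wAllExclAddGssAtThree_of_lowerMembers_of_divisibilityReading_of_sigmaStarOptOffRows` (PUB★⁺ → S2 → Σ★″ → L₁ → L₀ → leaf: Kolyvagin over a
split Heegner field in Matar–Nekovář's irreducible form at the optimal member, Manin-free). So, given print, the Jetchev reading S2 and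
the two LOWER halves, the W-ALL leaf Gss2 at `3` (BSD₃ for every non-CM additive I₀*-supersingular curve of analytic rank ≤ 1) is
EXACTLY ONE divisibility statement: Σ-form `3`-power divisibility of the derived Heegner points at the additive `3` (Jetchev 2008 Conj. 1.3
on the leaf, optimal members, off the mono-carrier rows). Named facts as hypotheses (17: Gross–Zagier, Kolyvagin, GZK, Version L,
GZ I.(7.3), MN Thm. 0.7 upper half, newform, Friedberg–Hoffstein, Bump–Friedberg–Hoffstein, parametrisation datum, Cassels, Mazur Cor. 4.1,
Abbes–Ullmo Thm. A, Česnavičius Thm. 1.2, Shimura reciprocity, Darmon Thm. 3.6, MN §0.11 structure half); S2, L₁, L₀ are route items BY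
NAME. CONDITIONAL; nothing asserted; BSD is not proved. [cite: Jetchev2008, Conj. 1.3 and Thm. 1.4 (p. 812)]
[cite: MatarNekovar2019, Thm. 0.7 (p. 456) and §0.11 (p. 457)] [cite: GrossZagier1986, Thm. I.(6.3), (7.3), V (2.2)]
[cite: Mazur1978, Cor. 4.1] [cite: Miller2011LMS, Def. 1.1] -/
theorem wAllExclAddGssAtThree_iff_leafSigmaStar_of_reading_of_lowerMembers
    (hGZ : ∀ (N : ℕ) [NeZero N] (W : WeierstrassCurve ℚ) (K : Type) [Field K] [NumberField K],
      gross_zagier N W K)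
    (hKo : ∀ (N : ℕ) [NeZero N] (W : WeierstrassCurve ℚ) (K : Type) [Field K] [NumberField K],
      kolyvagin N W K)
    (hGZK : rank_eq_analyticRank_of_analyticRank_le_one) (hmod : hasEntireLFunction_rat)
    (hGZ73 : GrossZagier1986_thm_I_7_3)
    (hMN7 : MatarNekovar2019.thm07_padicValNat_card_sha_primary_add_le_of_globalDivisibility_of_irreducible)
    (hnf : exists_isNewformOf)
    (hFH : friedbergHoffstein_exists_heegnerField_splitDivisors_twist_ne_zero)
    (hBFH : bumpFriedbergHoffstein_exists_heegnerField_split_twist_simpleZero)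
    (hMP : nonempty_modularParametrizationData)
    (hCassels : WeierstrassCurve.bsdRHS_eq_of_isIsogenous)
    (hM : mazur_not_dvd_maninConstant_of_odd) (hAU : abbesUllmo_not_dvd_maninConstant_of_not_dvd_level)
    (hC2 : cesnavicius_not_two_dvd_maninConstant_of_two_dvd_level)
    (hrec : ∀ (N : ℕ) [NeZero N] (W : WeierstrassCurve ℚ) (K : Type) [Field K] [NumberField K],
      heegnerPointOfConductor_one_galoisConj N W K)
    (h36 : ∀ (N : ℕ) [NeZero N] (W : WeierstrassCurve ℚ) (K : Type) [Field K] [NumberField K],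
      phi_heegnerTau_mem_range_map_singularModuliField N W K)
    (hMN : MatarNekovar2019.thm07_pow_dvd_card_sha_primary_of_certificate_of_irreducible)
    (hD : JetchevDivisibilityReadingS2) (hL1 : Gss2LowerAtThreeRankOne) (hL0 : Gss2LowerAtThreeRankZero) :
    Summit.BirchSwinnertonDyer.WAllExclAddGssAtThree ↔ LeafSigmaStarDivisibilityAtThreeOptimalOffRows :=
  ⟨fun hLeaf ↦ leafSigmaStarDivisibilityAtThreeOptimalOffRows_of_wAllExclAddGssAtThree hGZ hKo hGZK hmod hGZ73 hrec h36 hMN hM hAU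
      hC2 hnf hLeaf,
    fun hStar ↦ wAllExclAddGssAtThree_of_lowerMembers_of_divisibilityReading_of_sigmaStarOptOffRows
      ⟨hGZ, hKo, hGZK, hmod, hGZ73, hMN7, hnf, hFH, hBFH, hMP, hCassels, hM, hAU, hC2⟩ hD hStar hL1 hL0⟩

end Summit.BirchSwinnertonDyer.BirchSwinnertonDyer.Theorems.RamifiedPairUpperBound

end
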